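import Mathlib
import Summits.AtomisticToContinuum.Crystallization.Theses.ThreeConeCertificate
import Literature.MathematicalPhysics.StatisticalMechanics.BarlowStacking
import Literature.MathematicalPhysics.StatisticalMechanics.MuGroundStateConfiguration

/-!
# Sketch — crux-ideate stmt-AtomisticToContinuum-11960 (`SlackRigidity`), round 1, ideator 1

First lemmas of three candidate lines (statements, `sorry`ed except `rodAlias_onlyHcp`, which is
proved; the rest must merely elaborate).

* Card `c-layer-witness-strictness`: `cLayerWitness_iff` (the universal c-layer distance
  `√(16a²/3 + 4h²)` = `2√2·a` at the ideal ratio), and the deterministic transfer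
  `slackRigidity_of_strictStarCertificate`.
* Card `signed-root-silent-field`: `bochnerSlack_eq_fieldEnergy` (localisation of the Bochner
  cone by a convolution root) and `rodAlias_onlyHcp` (the finite rod-alias arithmetic at ideal c/a).
* Card `ekeland-surgery-parity`: `nearMinimiser_localSurgery` and `nearMinimiser_ekeland`.
-/

noncomputable section

open scoped BigOperators
open Filter MeasureTheory
open Literature.MathematicalPhysics.StatisticalMechanics

namespace Summit.AtomisticToContinuum.Crystallization.Cruxes.SlackRigidity.Sketch

local notation "E3" => EuclideanSpace ℝ (Fin 3)

/-! ## Card 1 — the universal c-layer witness distance -/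

/-- **c-layer witness.** For a Hägg sequence `s`, in-layer spacing `a > 0` and layer spacing `h`
with `h/a ∈ (0.775, 0.894)` (ideal `√(2/3) ≈ 0.8165`), the distance `√(16a²/3 + 4h²)` (= `2√2·a`
at the ideal ratio) is realised between two points of `barlowStacking a h s` **iff** `s` has a
cubic (`c`) layer, i.e. two equal consecutive signs. hcp (alternating) never realises it; fcc,
dhcp, 9R, a single fault all do. (Verified by exact rational enumeration, `calc/clayer.py`:
within `d² ≤ 12a²` it is the ONLY distance of any faulted stacking absent from hcp.) -/
theorem cLayerWitness_iff (a h : ℝ) (ha : 0 < a) (hh : 0.775 * a < h ∧ h < 0.894 * a)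
    (s : ℤ → ℤ) (hs : IsHaggSeq s) :
    (∃ x ∈ barlowStacking a h s, ∃ y ∈ barlowStacking a h s,
        dist x y ^ 2 = 16 * a ^ 2 / 3 + 4 * h ^ 2) ↔ ∃ m : ℤ, s m = s (m + 1) := by
  sorry

/-- One-centre (star) form of the `g`-stability of a certificate: a functional `F ≥ 0` of the
recentred `ρ'`-star whose sum over the particles is dominated by the `g`-slack
`Σ_{i<j} g + cN`. (This is how `c(g)` is to be certified anyway — fair-share reapportioning.) -/
def StarCertifies (g : ℝ → ℝ) (c ρ' : ℝ) (F : Set E3 → ℝ) : Prop :=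
  (∀ S, 0 ≤ F S) ∧
  ∀ (N : ℕ) (x : Fin N → E3), Function.Injective x →
    ∑ i, F ((fun j => x j - x i) '' {j | dist (x j) (x i) ≤ ρ'}) ≤
      interactionEnergy g x + c * N

/-- Exact, deterministic **zero-slack rigidity** of the two LOCAL cones: every uniformly discrete
infinite configuration all of whose `ρ'`-stars are equality cases of `F` and all of whose pair
distances are zeros of `U` is an isometric copy of `P.points`. -/
def ZeroSlackRigid (P : PeriodicConfiguration 3) (U : ℝ → ℝ) (F : Set E3 → ℝ) (ρ' : ℝ) : Prop :=
  ∀ S : Set E3, UniformlyDiscrete S → (0 : E3) ∈ S →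
    (∀ x ∈ S, F ((fun y => y - x) '' (S ∩ Metric.closedBall x ρ')) = 0) →
    (∀ x ∈ S, ∀ y ∈ S, x ≠ y → U (dist x y) = 0) →
    ∃ A : E3 →ₗᵢ[ℝ] E3, S = A '' P.points

/-- **Transfer (Card 1).** An exact three-cone certificate whose `g`-part is certified in star
form by a functional `F` that is continuous in the local matching topology, together with
zero-slack rigidity of `(U, F)` and conjunct (i)'s energy identification, gives `SlackRigidity`
— by local compactness of `δ`-separated sets (`exists_subseq_forall_eventually_ballMatch`),
Markov on the nonnegative local slack densities, and thinning of near-minimisers to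
`δ`-separated ones. The Bochner part `f` is spent on energy only. -/
theorem slackRigidity_of_strictStarCertificate
    (hcert : ∃ (P : PeriodicConfiguration 3) (ρ c ρ' : ℝ) (g U f : ℝ → ℝ) (F : Set E3 → ℝ),
      (∀ r : ℝ, 0 < r → lennardJones r = g r + U r + f r) ∧ (∀ r : ℝ, 0 < r → 0 ≤ U r) ∧
      ContinuousOn U (Set.Ioi 0) ∧ (∀ r : ℝ, ρ ≤ r → g r = 0) ∧
      (∀ (n : ℕ) (y : Fin n → E3) (w : Fin n → ℝ), 0 ≤ ∑ i, ∑ j, w i * w j * f (dist (y i) (y j))) ∧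
      StarCertifies g c ρ' F ∧
      (∀ ε > 0, ∃ η > 0, ∀ S T : Set E3, BallMatch η ρ' 0 S T → |F S - F T| ≤ ε) ∧
      ZeroSlackRigid P U F ρ' ∧
      c + f 0 / 2 = -(P.energyPerParticle lennardJones) ∧
      Tendsto (fun N : ℕ => groundStateEnergy lennardJones 3 N / N) atTop
        (nhds (P.energyPerParticle lennardJones))) :
    Summit.AtomisticToContinuum.Crystallization.Theses.ThreeConeCertificate.SlackRigidity := by
  sorry

/-! ## Card 2 — signed convolution root: the Bochner slack is the energy of a local field -/

/-- The **slack field** of a finite configuration for a kernel `h`: `Φ(y) = Σ_i h(y − x_i)`. -/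
def slackField {N : ℕ} (h : E3 → ℝ) (x : Fin N → E3) (y : E3) : ℝ := ∑ i, h (y - x i)

/-- **Localisation identity.** If `f(z) = ∫ h(y) h(y + z) dy` is the autocorrelation of a kernel
`h ∈ L¹ ∩ L²` (a signed root: `ĥ = q` real with `q² = f̂`, sign flipping across each Bragg sphere
so that `q` is smooth and `h` integrable), then the Bochner double sum — the third slack of the
certificate — is the `L²`-energy of the local field `Φ`:
`Σ_i Σ_j f(x_i − x_j) = ∫ Φ(y)² dy ≥ 0`, pointwise nonnegative density `Φ²`. -/
theorem bochnerSlack_eq_fieldEnergy (h : E3 → ℝ) (hh₁ : Integrable h) (hh₂ : MemLp h 2)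
    {N : ℕ} (x : Fin N → E3) :
    ∑ i, ∑ j, (∫ y, h y * h (y + (x i - x j))) = ∫ y, (slackField h x y) ^ 2 := by
  sorry

/-- **Rod-alias lemma (ideal `c/a`, rod class `N_G = 1`, finite form).** The non-extinct hcp
Bragg radii with `Q = |k|²/(2π)² ≤ 3` are `Q ∈ {4/3, 3/2, 41/24, 17/6}`; on the stacking-sensitive
rod `(10)` a height `ℓ` has `Q(ℓ) = 4/3 + 3ℓ²/8`. If a rod frequency `ℓ₀ ∈ [0,2)` has BOTH aliases
`ℓ₀` and `ℓ₀ − 2` (the ones with `Q ≤ 3`, besides `ℓ₀ + 2` when small) on hcp spheres, then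
`ℓ₀ ∈ {0, 1}` — the two frequencies of the `ABAB` phase sequence. Hence a radial positive-type
`f` with `f̂ > 0` on `{Q ≤ 3}` off these four spheres silences only hcp among layered stackings.
(`calc/rods.py` checks the same on rods `N_G = 4, 7` with ten aliases.) -/
theorem rodAlias_onlyHcp (ℓ₀ : ℝ) (h0 : 0 ≤ ℓ₀) (h2 : ℓ₀ < 2)
    (S : Set ℝ) (hS : S = {4 / 3, 3 / 2, 41 / 24, 17 / 6})
    (halias : ∀ m : ℤ, 4 / 3 + 3 * (ℓ₀ + 2 * m) ^ 2 / 8 ≤ 3 →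
      4 / 3 + 3 * (ℓ₀ + 2 * m) ^ 2 / 8 ∈ S) :
    ℓ₀ = 0 ∨ ℓ₀ = 1 := by
  subst hS
  -- the two aliases with Q ≤ 3: m = 0 (height ℓ₀) and m = -1 (height ℓ₀ - 2)
  have hA := halias 0 (by push_cast; nlinarith [h0, h2])
  have hB := halias (-1) (by push_cast; nlinarith [h0, h2])
  push_cast at hA hB
  simp only [Set.mem_insert_iff, Set.mem_singleton_iff] at hA hB
  have hsq : (ℓ₀ + 2 * 0) ^ 2 = ℓ₀ ^ 2 := by ring
  have hsq' : (ℓ₀ + 2 * (-1)) ^ 2 = (ℓ₀ - 2) ^ 2 := by ring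
  rw [hsq] at hA
  rw [hsq'] at hB
  rcases hA with hA | hA | hA | hA
  · -- ℓ₀² = 0
    left
    have : ℓ₀ ^ 2 = 0 := by linarith
    exact pow_eq_zero_iff (n := 2) (by norm_num) |>.1 this
  · -- ℓ₀² = 4/9, i.e. ℓ₀ = 2/3 (fcc's frequency): its alias ℓ₀ - 2 = -4/3 has Q = 2, off the spheres
    exfalso
    have h23 : ℓ₀ = 2 / 3 := by nlinarith [h0]
    subst h23
    rcases hB with hB | hB | hB | hB <;> norm_num at hB
  · -- ℓ₀² = 1
    right
    nlinarith [h0]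
  · -- ℓ₀² = 4 contradicts ℓ₀ < 2
    exfalso
    nlinarith [h0, h2]

/-! ## Card 3 — Ekeland + separated-ball surgery: near-minimisers are ground states in the limit -/

/-- **Local surgery in density.** Along an `o(N)`-excess sequence, for every radius `R` and gain
`δ > 0`, the particles `i` around which SOME particle-number-preserving rearrangement confined
to `B_R(x_i)` lowers the energy by at least `δ` have density `→ 0` (perform the rearrangements
simultaneously on an `L`-separated subfamily; the `r⁻⁶` tail decouples them; the total gain
would beat `E(N)`). In the local limit: every configuration charged by the sequence is a
ground-state configuration (no compact modification lowers the energy). -/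
theorem nearMinimiser_localSurgery (R δ : ℝ) (hR : 0 < R) (hδ : 0 < δ)
    (x : (N : ℕ) → (Fin N → E3)) (hx : ∀ N, Function.Injective (x N))
    (hex : Tendsto (fun N : ℕ => (interactionEnergy lennardJones (x N) -
      groundStateEnergy lennardJones 3 N) / N) atTop (nhds 0)) :
    Tendsto (fun N : ℕ => (Nat.card {i : Fin N // ∃ y : Fin N → E3, Function.Injective y ∧
        (∀ j, R < dist (x N j) (x N i) → y j = x N j) ∧
        (∀ j, dist (x N j) (x N i) ≤ R → dist (y j) (x N i) ≤ R) ∧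
        interactionEnergy lennardJones y ≤ interactionEnergy lennardJones (x N) - δ} : ℝ) / N)
      atTop (nhds 0) := by
  sorry

/-- The Lennard-Jones force on particle `i` (gradient of the interaction energy in `x_i`, up to
sign): `Σ_{j ≠ i} V'(r_ij) (x_i − x_j)/r_ij`. -/
def ljForce {N : ℕ} (x : Fin N → E3) (i : Fin N) : E3 :=
  ∑ j ∈ Finset.univ.erase i,
    (deriv lennardJones (dist (x i) (x j)) / dist (x i) (x j)) • (x i - x j)

/-- **Ekeland parity.** Every `o(N)`-excess sequence can be replaced, at `o(N)` cost in `ℓ²`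
(hence changing `(R, ε)`-bad counts by `o(N)` only), by one of no larger energy whose forces are
`o(N)` in `ℓ²`: near-minimisers are WLOG near-critical, so their local limits are equilibrium
configurations exactly as those of ground states (Ekeland's variational principle in `ℝ^{3N}`
with `E = +∞` on collisions). -/
theorem nearMinimiser_ekeland
    (x : (N : ℕ) → (Fin N → E3)) (hx : ∀ N, Function.Injective (x N))
    (hex : Tendsto (fun N : ℕ => (interactionEnergy lennardJones (x N) -
      groundStateEnergy lennardJones 3 N) / N) atTop (nhds 0)) :
    ∃ y : (N : ℕ) → (Fin N → E3), (∀ N, Function.Injective (y N)) ∧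
      (∀ N, interactionEnergy lennardJones (y N) ≤ interactionEnergy lennardJones (x N)) ∧
      Tendsto (fun N : ℕ => (∑ i, dist (y N i) (x N i) ^ 2) / N) atTop (nhds 0) ∧
      Tendsto (fun N : ℕ => (∑ i, ‖ljForce (y N) i‖ ^ 2) / N) atTop (nhds 0) := by
  sorry

end Summit.AtomisticToContinuum.Crystallization.Cruxes.SlackRigidity.Sketch

end
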